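import Summits.QuantumFields.YangMills.Theorems.FluctuationComparisonRegPrIntLSupTailCoverUnionTotal
import Summits.QuantumFields.YangMills.Theorems.FluctuationComparisonRegPrIntLTailSupOneFarPlaquetteCost
import Summits.QuantumFields.YangMills.Theorems.FluctuationComparisonRegPrIntLTailSupOneDeletedTermJensen
import Literature.MathematicalPhysics.QuantumFieldTheory.Balaban1983to89.T4PairDerivBridge
import HarnessLib

/-!
# `FluctuationComparisonRegPrIntLSupTailCoverUnionTwoRegime` — TWO REGIMES PER FINE PLAQUETTE (moderate ∕ far) IN TOTAL-MASS CURRENCY, THE FAR ONE DISCHARGED DOWN TO A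
# FIRST MOMENT (✓H far-plaquette cost + ✓I Jensen + ✓L setwise reading), and the knit to TAILSUP₁∘ `WindowOddsSupDepthOneIntCan` verbatim
# (crux `UnitScaleTilt.FluctuationComparisonRegPrIntL`, stmt-QuantumFields-20520; companion of ✓N `…SupTailCoverUnionTotal`, ✓H `…TailSupOneFarPlaquetteCost`, ✓I `…TailSupOneDeletedTermJensen`)

Cell `ym3-torus` (YM ladder rung R3 = continuum SU(2) Yang–Mills on T³ — a RUNG, NOT the Clay problem: not d = 4, not infinite volume, not a mass gap);
width seat `ym-ust-20520-w3` (gen 17); helper `--supports stmt-QuantumFields-20520`.  THEOREMS ONLY (0 `def`, 0 `sorry`, default heartbeats).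

WHAT.  At depth one the bad histories above a window datum are covered by the fine field's own large plaquettes `{θ_{J+1} ≤ dist1(U(∂p))}` (✓M); split each at a fixed
`δ₀` into the MODERATE regime `θ_{J+1} ≤ dist1(U(∂p)) < δ₀` (chart + convexity one level deep: ✓E∕✓G∕E-CHART∕F-BOX's input side) and the FAR regime `δ₀ ≤ dist1(U(∂p))`
(Wilson-action cost `e^{−β_{J+1}δ₀²∕4}`: ✓H).  In TOTAL-mass currency (✓N) the far regime is discharged here down to ONE number per level:
* §1 ★★`condGoodOddsDepthOne_of_modFarRowsFineTotal` — moderate rows `μ(D⁻¹B ∩ MOD_p) ≤ ofReal(σm_p)·μ(D⁻¹B)`, far rows `μ(D⁻¹B ∩ FAR_p) ≤ ofReal(σf_p)·μ(D⁻¹B)`,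
  `Σσm + Σσf ≤ ½`, `B ⊆ {PlaqSmall (θ J)}` ⇒ COND-ODDS at `(J, J+1)` with `e^{2(Σσm + Σσf)}` (✓N `measure_le_exp_mul_inter_of_cover_total` on `T_{J+1} ⊕ T_{J+1}`).
* §2 `neZero_withDensity_exp` · `integrable_plaqTerm_withDensity` (SU(2): `0 ≤ 1 − reTr ≤ ½·dist1² ≤ 2`) · ★★★`farPinnedTotal_of_firstMoment` — at any `(J, K)`, fine plaquette
  `p ∈ T_K`, `δ₀ ≥ 0`: if for `(dU_K.map D_{J,K})`-a.e. window datum `V` the MEAN OF ONE PLAQUETTE'S TILTED ACTION under the deleted-weight fibre law is bounded,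
  `⨍ β_K(1 − reTr U(∂p)) d(κ_V.withDensity e^{−β_K A_{¬p}}) ≤ M`, then for every measurable `B` inside the window
  `Gibbs_K(D⁻¹B ∩ {δ₀ ≤ dist1(U(∂p))}) ≤ ofReal(e^{−β_Kδ₀²∕4}·e^{M})·Gibbs_K(D⁻¹B)` (✓I `deletedPartition_le_of_average` fibrewise ⇒ ✓H `gibbsK_restrict_map_farPinned_le` at
  `G := univ` ⇒ ✓L `setwise_of_restrict_map_le_smul`).  Window profile `(γ, b₀, p₀)` free (interior windows: `b₀ ↦ c·b₀`).
* §3 ★★★`condGoodOddsDepthOneInt_of_modTotal_farMoment : ⟨MOD-TOTAL₁∘ + FAR-MOMENT₁∘ + FLOOR⟩ → ✓K's ⟨COND-ODDS₁∘⟩ verbatim` · ★★★`windowOddsSupDepthOneInt_of_modTotal_farMoment :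
  … → TAILSUP₁∘ verbatim` (∘ ✓K).  THE SMALLNESS IS EVENTUAL (`s J ≤ ½` only for `J ≥ J₀`, `J₀` chosen after `F`): at small `J` the union bound over the `#T_{J+1} ≍ L^{3m+3(J+1)}`
  fine plaquettes exceeds `½` once the torus exponent `F.m` is large (px21 g13's satisfiability flag, 05:01Z — a `∀ J, s J ≤ ½` clause would make the hypothesis
  unsatisfiable over all families), so the finitely many levels `J < J₀` are carried by a FLOOR row `ofReal(q J)·Gibbs_{J+1}(D⁻¹B) ≤ Gibbs_{J+1}(D⁻¹B ∩ histGood)`, `q J > 0`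
  (LINE g22-2's persistence ∕ positivity row at depth one), and `τ J := if J < J₀ then max 0 (−log q J) else 2·s J` — non-negative, eventually `2·s`, superpolynomial.
HONEST SCOPE.  Measure arithmetic + the SU(2) plaquette bound; the moderate rows, the first-moment bounds `M J`, the eventual smallness and the floor are the HYPOTHESIS;
TAILSUP₁∘, MOD₁∘, FAR₁, LFR♯ᶜ∘, S2β, 20520, `YM3TorusSU2` NOT proved; the Yang–Mills mass gap is NOT proved.
HYP-SAT (cell RULING №42).  Every letter of §3's hypothesis (`δ₀, J₀, s, q, σm, M`) is bound AFTER `F, γ`, so on the literal T³ families the hypothesis is satisfiable at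
the true quantifier order modulo its analytic contents (moderate tails, equipartition moment, large-`p₀` arithmetic for `J ≥ J₀(F)`, and the floor at `J < J₀(F)`); no hand
has supplied them yet; a `∀ J, s J ≤ ½` edition (✓N §4∕§5) is NOT satisfiable uniformly in `F.m` and is superseded by this file.
References: [Balaban1985UV3] (2) p. 256, (7) p. 257, (11) p. 258, (38)–(40) p. 266, (67)–(71) p. 273; [Balaban1985Averaging] (10) p. 19.
-/

noncomputable section

set_option autoImplicit false

open MeasureTheory ProbabilityTheory Filter Topology Set
open scoped ENNReal NNReal BigOperators
open Literature.MathematicalPhysics.QuantumFieldTheory.Balaban1983to89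
open Literature.MathematicalPhysics.QuantumFieldTheory.Balaban1983to89.T3ContinuumYM3Torus
open Literature.MathematicalPhysics.QuantumFieldTheory.Balaban1983to89.T3NestedUnitLaws
open Literature.MathematicalPhysics.QuantumFieldTheory.Balaban1983to89.T3UnitLawDensityEML
open Literature.MathematicalPhysics.QuantumFieldTheory.Balaban1983to89.T3UnitScaleTilt
open Literature.MathematicalPhysics.QuantumFieldTheory.Balaban1983to89.T3TiltDescent
open Literature.MathematicalPhysics.QuantumFieldTheory.Balaban1983to89.Missing
open Literature.MathematicalPhysics.QuantumFieldTheory.Balaban1983to89.T4AveragingDisintegration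
open scoped Literature.MathematicalPhysics.QuantumFieldTheory.Balaban1983to89.T3OrbitAverage
open Summit.QuantumFields.YangMills.Theorems.FluctuationComparisonRegPrIntLWregGlue (heightDensityCan)
open Summit.QuantumFields.YangMills.Theorems.FluctuationComparisonRegPrIntLSupTailCoverUnionDepthOne (preimage_diff_histGood_subset_fine)
open Summit.QuantumFields.YangMills.Theorems.FluctuationComparisonRegPrIntLSupTailCoverUnionTotal (measure_le_exp_mul_inter_of_cover_total)

namespace Summit.QuantumFields.YangMills.Theorems.FluctuationComparisonRegPrIntLSupTailCoverUnionTwoRegime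

/-! ## §1 Depth one, two regimes per fine plaquette, total-mass currency -/

section TwoRegime

variable (F : T3Family) {γ : ℝ} (hγ : 0 ≤ γ) (θ : ℕ → ℝ) (J : ℕ) (δ₀ : ℝ)
include hγ

/-- ★★ **COND-ODDS AT `(J, J+1)` ⟸ MODERATE + FAR ROWS PER FINE PLAQUETTE, TOTAL MASS**: with `MOD_p = {θ_{J+1} ≤ dist1(U(∂p)) < δ₀}`, `FAR_p = {δ₀ ≤ dist1(U(∂p))}`,
rows `μ(D⁻¹B ∩ MOD_p) ≤ ofReal(σm_p)·μ(D⁻¹B)` and `μ(D⁻¹B ∩ FAR_p) ≤ ofReal(σf_p)·μ(D⁻¹B)` (`σm, σf ≥ 0`, `Σ_pσm_p + Σ_pσf_p ≤ ½`) and `B ⊆ {PlaqSmall (θ J)}` give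
`μ(D⁻¹B) ≤ ofReal(e^{2(Σσm + Σσf)})·μ(D⁻¹B ∩ histGood θ (J+1) J)` (`μ = Gibbs_{J+1}`; ✓M's cover split at `δ₀`, ✓N's total glue on `T_{J+1} ⊕ T_{J+1}`).
[cite: Balaban1985UV3, (7) p.257 and (38)-(40) p.266] -/
theorem condGoodOddsDepthOne_of_modFarRowsFineTotal (σm σf : Plaq (F.P (J + 1)) 0 → ℝ) (hσm : ∀ p, 0 ≤ σm p) (hσf : ∀ p, 0 ≤ σf p)
    (hsum : ∑ p : Plaq (F.P (J + 1)) 0, σm p + ∑ p : Plaq (F.P (J + 1)) 0, σf p ≤ 1 / 2)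
    {B : Set (GaugeField (F.P J) 0 (Matrix.specialUnitaryGroup (Fin 2) ℂ))} (hBJ : B ⊆ {U | PlaqSmall (θ J) U})
    (hmod : ∀ p : Plaq (F.P (J + 1)) 0,
      gibbsK F ℰp γ (J + 1) (descendTo F ℰp J (J + 1) (Nat.le_succ J) ⁻¹' B ∩
          {U | θ (J + 1) ≤ dist1 (GaugeField.plaqHol U p) ∧ dist1 (GaugeField.plaqHol U p) < δ₀}) ≤
        ENNReal.ofReal (σm p) * gibbsK F ℰp γ (J + 1) (descendTo F ℰp J (J + 1) (Nat.le_succ J) ⁻¹' B))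
    (hfar : ∀ p : Plaq (F.P (J + 1)) 0,
      gibbsK F ℰp γ (J + 1) (descendTo F ℰp J (J + 1) (Nat.le_succ J) ⁻¹' B ∩ {U | δ₀ ≤ dist1 (GaugeField.plaqHol U p)}) ≤
        ENNReal.ofReal (σf p) * gibbsK F ℰp γ (J + 1) (descendTo F ℰp J (J + 1) (Nat.le_succ J) ⁻¹' B)) :
    gibbsK F ℰp γ (J + 1) (descendTo F ℰp J (J + 1) (Nat.le_succ J) ⁻¹' B) ≤
      ENNReal.ofReal (Real.exp (2 * (∑ p : Plaq (F.P (J + 1)) 0, σm p + ∑ p : Plaq (F.P (J + 1)) 0, σf p))) *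
        gibbsK F ℰp γ (J + 1) (descendTo F ℰp J (J + 1) (Nat.le_succ J) ⁻¹' B ∩ histGood F ℰp θ (J + 1) J) := by
  haveI := isProbabilityMeasure_gibbsK F ℰp hγ (J + 1)
  have hsum' : ∑ x : Plaq (F.P (J + 1)) 0 ⊕ Plaq (F.P (J + 1)) 0, Sum.elim σm σf x ≤ 1 / 2 := by
    rw [Fintype.sum_sum_type]; simpa using hsum
  have hkey := measure_le_exp_mul_inter_of_cover_total (gibbsK F ℰp γ (J + 1)) (Finset.univ : Finset (Plaq (F.P (J + 1)) 0 ⊕ Plaq (F.P (J + 1)) 0))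
    (Sum.elim (fun p => {U : GaugeField (F.P (J + 1)) 0 (Matrix.specialUnitaryGroup (Fin 2) ℂ) |
        θ (J + 1) ≤ dist1 (GaugeField.plaqHol U p) ∧ dist1 (GaugeField.plaqHol U p) < δ₀})
      (fun p => {U | δ₀ ≤ dist1 (GaugeField.plaqHol U p)}))
    (A := descendTo F ℰp J (J + 1) (Nat.le_succ J) ⁻¹' B)
    (measurableSet_histGood F ℰp measurableE_ℰp θ (J + 1) J) ?_ (Sum.elim σm σf) ?_ hsum' ?_
  · rw [Fintype.sum_sum_type] at hkey
    simpa using hkey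
  · -- the cover: ✓M's fine cover, split at `δ₀`
    intro U hU
    have hU' := preimage_diff_histGood_subset_fine F θ J hBJ hU
    simp only [Set.mem_iUnion, Finset.mem_univ, exists_true_left, Set.mem_setOf_eq] at hU'
    obtain ⟨p, hp⟩ := hU'
    simp only [Set.mem_iUnion, Finset.mem_univ, exists_true_left]
    by_cases hlt : dist1 (GaugeField.plaqHol U p) < δ₀
    · exact ⟨Sum.inl p, by simp only [Sum.elim_inl, Set.mem_setOf_eq]; exact ⟨hp, hlt⟩⟩
    · exact ⟨Sum.inr p, by simp only [Sum.elim_inr, Set.mem_setOf_eq]; exact (not_lt.mp hlt)⟩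
  · rintro (p | p) _
    · exact hσm p
    · exact hσf p
  · rintro (p | p) _
    · simpa only [Sum.elim_inl] using hmod p
    · simpa only [Sum.elim_inr] using hfar p

end TwoRegime

/-! ## §2 The far regime down to a first moment: ✓I (Jensen) fibrewise ⇒ ✓H (far plaquette cost, `G := univ`) ⇒ ✓L (setwise) -/

section FarMoment

/-- A probability measure re-weighted by `e^{φ}` is non-zero. [folklore] -/
theorem neZero_withDensity_exp {X : Type*} [MeasurableSpace X] (κ : Measure X) [IsProbabilityMeasure κ] {φ : X → ℝ} (hφ : Measurable φ) :
    NeZero (κ.withDensity fun x => ENNReal.ofReal (Real.exp (φ x))) := by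
  refine ⟨fun h0 => ?_⟩
  have h1 : ∫⁻ x, ENNReal.ofReal (Real.exp (φ x)) ∂κ = 0 := by
    have := congrArg (fun μ : Measure X => μ Set.univ) h0
    simp only [Measure.coe_zero, Pi.zero_apply, withDensity_apply _ MeasurableSet.univ, Measure.restrict_univ] at this
    exact this
  rw [lintegral_eq_zero_iff hφ.exp.ennreal_ofReal] at h1
  have h2 : κ Set.univ = 0 := by
    have h3 := (ae_iff.mp h1)
    have hset : {x : X | ¬(fun x => ENNReal.ofReal (Real.exp (φ x))) x = (0 : X → ℝ≥0∞) x} = Set.univ := by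
      ext x
      simp only [Pi.zero_apply, ENNReal.ofReal_eq_zero, not_le, Set.mem_setOf_eq, Set.mem_univ, iff_true]
      exact Real.exp_pos _
    rwa [hset] at h3
  exact one_ne_zero (measure_univ.symm.trans h2)

/-- One plaquette's tilted action `β(1 − Re tr U(∂p))` is integrable under any finite measure on `SU(2)` fields: `0 ≤ 1 − reTr ≤ ½·dist1² ≤ 2` (lit (11) p.258 and
`dist1 ≤ 2` on `SU(2)`). [cite: Balaban1985UV3, (11) p.258] -/
theorem integrable_plaqTerm {P : Params} (ρ : Measure (GaugeField P 0 (Matrix.specialUnitaryGroup (Fin 2) ℂ))) [IsFiniteMeasure ρ] (β : ℝ) (p : Plaq P 0) :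
    Integrable (fun U => β * (1 - reTr (GaugeField.plaqHol U p))) ρ := by
  have hmeas : Measurable fun U : GaugeField P 0 (Matrix.specialUnitaryGroup (Fin 2) ℂ) => β * (1 - reTr (GaugeField.plaqHol U p)) :=
    (measurable_const.sub (RegularGaugeGroup.measurable_reTr.comp (Missing.measurable_plaqHol p))).const_mul β
  refine (integrable_const (|β| * 2)).mono' hmeas.aestronglyMeasurable (Eventually.of_forall fun U => ?_)
  have h0 : 0 ≤ 1 - reTr (GaugeField.plaqHol U p) := sub_nonneg.mpr (GaugeGroup.reTr_le_one _)
  have h2 : 1 - reTr (GaugeField.plaqHol U p) ≤ 2 := by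
    have hd := T4PairDerivBridge.dist1_le_two_specialUnitaryGroup (GaugeField.plaqHol U p)
    have hd0 := GaugeGroup.dist1_nonneg (GaugeField.plaqHol U p)
    have := B10Eq5RegularAction.one_sub_reTr_le_specialUnitaryGroup (GaugeField.plaqHol U p)
    nlinarith
  rw [Real.norm_eq_abs, abs_mul, abs_of_nonneg h0]
  exact mul_le_mul_of_nonneg_left h2 (abs_nonneg β)

variable (F : T3Family) {γ : ℝ} (b₀ p₀ : ℝ) {J K : ℕ} (hJK : J ≤ K)

/-- ★★★ **THE FAR-PINNED ROW, TOTAL MASS, FROM A FIRST MOMENT**: `γ ≥ 0`, `δ₀ ≥ 0`, a fine plaquette `p ∈ T_K`, and for `(dU_K.map D_{J,K})`-a.e. window datum `V` a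
bound `⨍ β_K(1 − Re tr U(∂p)) d(κ_V.withDensity e^{−β_K A_{¬p}}) ≤ M` on the mean of ONE plaquette's tilted action under the deleted-weight conditional Haar law
(`κ_V = condLaw dU_K D_{J,K} V`).  Then for every measurable `B` inside the height-`J` window `{PlaqSmall (θBal L γ b₀ p₀ J)}`:
`Gibbs_K(D⁻¹B ∩ {δ₀ ≤ dist1(U(∂p))}) ≤ ofReal(e^{−β_Kδ₀²∕4}·e^{M})·Gibbs_K(D⁻¹B)` — ✓I `deletedPartition_le_of_average` on each fibre gives ✓H's `hdel` at `G := univ`,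
`C := e^{M}`; ✓H `gibbsK_restrict_map_farPinned_le`; ✓L `setwise_of_restrict_map_le_smul`.  Profile `(γ, b₀, p₀)` free: interior windows by `b₀ ↦ c·b₀`.
[cite: Balaban1985UV3, (67)-(71) p.273; Balaban1985Averaging, (10) p.19] -/
theorem farPinnedTotal_of_firstMoment (hγ : 0 ≤ γ) {δ₀ : ℝ} (hδ : 0 ≤ δ₀) (p : Plaq (F.P K) 0) {M : ℝ}
    (hmom : ∀ᵐ V ∂((fieldMeasure (F.P K) 0 (Matrix.specialUnitaryGroup (Fin 2) ℂ)).map (descendTo F ℰp J K hJK)),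
      PlaqSmall (θBal F.L γ b₀ p₀ J) V →
        ⨍ U, (F.scheme ℰp γ).β K * (1 - reTr (GaugeField.plaqHol U p))
          ∂((condLaw (fieldMeasure (F.P K) 0 (Matrix.specialUnitaryGroup (Fin 2) ℂ)) (descendTo F ℰp J K hJK) V).withDensity fun U =>
            ENNReal.ofReal (Real.exp (-((F.scheme ℰp γ).β K * (wilsonAction4 U - (1 - reTr (GaugeField.plaqHol U p))))))) ≤ M)
    {B : Set (GaugeField (F.P J) 0 (Matrix.specialUnitaryGroup (Fin 2) ℂ))} (hB : MeasurableSet B) (hBW : B ⊆ {U | PlaqSmall (θBal F.L γ b₀ p₀ J) U}) :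
    gibbsK F ℰp γ K (descendTo F ℰp J K hJK ⁻¹' B ∩ {U | δ₀ ≤ dist1 (GaugeField.plaqHol U p)}) ≤
      ENNReal.ofReal (Real.exp (-((F.scheme ℰp γ).β K * δ₀ ^ 2 / 4)) * Real.exp M) * gibbsK F ℰp γ K (descendTo F ℰp J K hJK ⁻¹' B) := by
  have hβ : 0 ≤ (F.scheme ℰp γ).β K := F.scheme_β_nonneg ℰp hγ K
  have hD : Measurable (descendTo F ℰp J K hJK) := measurable_descendTo F ℰp measurableE_ℰp hJK
  -- ✓I fibrewise: the deleted partition against the full Boltzmann mass (`G := univ`, `C := e^{M}`)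
  have hdel : ∀ᵐ V ∂((fieldMeasure (F.P K) 0 (Matrix.specialUnitaryGroup (Fin 2) ℂ)).map (descendTo F ℰp J K hJK)),
      PlaqSmall (θBal F.L γ b₀ p₀ J) V →
        ∫⁻ U, ENNReal.ofReal (Real.exp (-((F.scheme ℰp γ).β K * (wilsonAction4 U - (1 - reTr (GaugeField.plaqHol U p))))))
            ∂(condLaw (fieldMeasure (F.P K) 0 (Matrix.specialUnitaryGroup (Fin 2) ℂ)) (descendTo F ℰp J K hJK) V) ≤
          ENNReal.ofReal (Real.exp M) * ∫⁻ U in Set.univ, ENNReal.ofReal (boltzmann (F.P K) ((F.scheme ℰp γ).β K) U)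
            ∂(condLaw (fieldMeasure (F.P K) 0 (Matrix.specialUnitaryGroup (Fin 2) ℂ)) (descendTo F ℰp J K hJK) V) := by
    filter_upwards [hmom] with V hV hVW
    rw [Measure.restrict_univ]
    set κ := condLaw (fieldMeasure (F.P K) 0 (Matrix.specialUnitaryGroup (Fin 2) ℂ)) (descendTo F ℰp J K hJK) V with hκ
    have hφ : Measurable fun U : GaugeField (F.P K) 0 (Matrix.specialUnitaryGroup (Fin 2) ℂ) =>
        -((F.scheme ℰp γ).β K * (wilsonAction4 U - (1 - reTr (GaugeField.plaqHol U p)))) :=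
      (((measurable_wilsonAction4 RegularGaugeGroup.measurable_reTr).sub
        (measurable_const.sub (RegularGaugeGroup.measurable_reTr.comp (Missing.measurable_plaqHol p)))).const_mul _).neg
    haveI := neZero_withDensity_exp κ hφ
    haveI := FluctuationComparisonRegPrIntLTailSupOneDeletedTermJensen.isFiniteMeasure_withDensity_deleted κ hβ p
    exact FluctuationComparisonRegPrIntLTailSupOneDeletedTermJensen.deletedPartition_le_of_average κ hβ p
      (integrable_plaqTerm _ _ p) (hV hVW)
  -- ✓H: the far row in ✓E's shape at `G := univ`
  have hrow := FluctuationComparisonRegPrIntLTailSupOneFarPlaquetteCost.gibbsK_restrict_map_farPinned_le F b₀ p₀ hJK hγ hδ p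
    MeasurableSet.univ hdel
  rw [Measure.restrict_univ] at hrow
  -- ✓L: read setwise at `B`
  have hset := FluctuationComparisonRegPrIntLSupTailCoverUnion.setwise_of_restrict_map_le_smul (gibbsK F ℰp γ K) hD
    (E := {U : GaugeField (F.P K) 0 (Matrix.specialUnitaryGroup (Fin 2) ℂ) | δ₀ ≤ dist1 (GaugeField.plaqHol U p)}) (G := Set.univ)
    (by rwa [Measure.restrict_univ]) hB hBW
  rwa [Set.inter_univ] at hset

end FarMoment

/-! ## §3 The knit: moderate rows (total mass) + far first moments + smallness ⇒ ✓K's ⟨COND-ODDS₁∘⟩ ⇒ TAILSUP₁∘ verbatim -/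

section Knit

/-- **FLOOR ⇒ ODDS** (`ℝ≥0∞` arithmetic): `ofReal(q)·a ≤ b` with `q > 0` gives `a ≤ ofReal(e^{max 0 (−log q)})·b`. [folklore] -/
theorem le_exp_negLog_mul_of_floor {a b : ℝ≥0∞} {q : ℝ} (hq : 0 < q) (h : ENNReal.ofReal q * a ≤ b) :
    a ≤ ENNReal.ofReal (Real.exp (max 0 (-Real.log q))) * b := by
  have hq0 : ENNReal.ofReal q ≠ 0 := by rwa [Ne, ENNReal.ofReal_eq_zero, not_le]
  have h1 : a ≤ (ENNReal.ofReal q)⁻¹ * b := by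
    calc a = (ENNReal.ofReal q)⁻¹ * (ENNReal.ofReal q * a) := by
          rw [← mul_assoc, ENNReal.inv_mul_cancel hq0 ENNReal.ofReal_ne_top, one_mul]
      _ ≤ (ENNReal.ofReal q)⁻¹ * b := mul_le_mul' le_rfl h
  refine h1.trans (mul_le_mul' ?_ le_rfl)
  rw [← ENNReal.ofReal_inv_of_pos hq]
  refine ENNReal.ofReal_le_ofReal ?_
  rw [← Real.exp_log (inv_pos.mpr hq), Real.log_inv]
  exact Real.exp_le_exp.mpr (le_max_right _ _)

/-- A profile that is EVENTUALLY `2·s` inherits `s`'s superpolynomial smallness. [folklore] -/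
theorem superpoly_of_eventually_eq {s τ : ℕ → ℝ} (J₀ : ℕ) (hτ : ∀ J, J₀ ≤ J → τ J = 2 * s J)
    (hs : ∀ a : ℕ, Tendsto (fun J : ℕ => ((J : ℝ) + 1) ^ a * s J) atTop (𝓝 0)) (a : ℕ) :
    Tendsto (fun J : ℕ => ((J : ℝ) + 1) ^ a * τ J) atTop (𝓝 0) := by
  have h2 := (hs a).const_mul 2
  rw [mul_zero] at h2
  refine h2.congr' ?_
  filter_upwards [eventually_ge_atTop J₀] with J hJ
  rw [hτ J hJ]; ring

/-- ★★★ **⟨MOD-TOTAL₁∘ + FAR-MOMENT₁∘ + FLOOR⟩ ⇒ ✓K's ⟨COND-ODDS₁∘⟩ VERBATIM.**  Hypothesis (TAILSUP₁∘'s quantifier prefix, then; everything chosen AFTER `F, γ`): a splitting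
radius `δ₀ ≥ 0`, a threshold level `J₀`, a smallness profile `s ≥ 0` superpolynomially small with `s J ≤ ½` for `J ≥ J₀` (EVENTUAL — see the file header: at small `J` the
plaquette count `#T_{J+1} ≍ L^{3m+3J+3}` defeats any union bound once `F.m` is large), a floor `q J > 0`, moderate weights `σm ≥ 0` and far moments `M J` with
`Σ_p σm J p + #T_{J+1}·e^{−β_{J+1}δ₀²∕4}·e^{M J} ≤ s J`, and: (FLOOR) for `J < J₀` and measurable `B` in the interior window `ofReal(q J)·Gibbs_{J+1}(D⁻¹B) ≤ Gibbs_{J+1}(D⁻¹B ∩ histGood)`;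
(MOD) `Gibbs_{J+1}(D⁻¹B ∩ {θBal L γ b₀ p₀ (J+1) ≤ dist1 U(∂p) < δ₀}) ≤ ofReal(σm J p)·Gibbs_{J+1}(D⁻¹B)`; (FAR) a.e. interior-window datum: `⨍ β_{J+1}(1 − Re tr U(∂p)) d(κ_V.withDensity
e^{−β_{J+1}A_{¬p}}) ≤ M J`.  Conclusion ✓K's ⟨COND-ODDS₁∘⟩ with `τ J := if J < J₀ then max 0 (−log q J) else 2·s J` (interior window inside the history window by lit
`θBal_mul_le`, `c ≤ c₀ ≤ 1`, `γ ≤ 1` — `γ₁ ↦ min γ₁ 1`). [cite: Balaban1985UV3, (2) p.256, (7) p.257, (38)-(40) p.266 and (67)-(71) p.273] -/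
theorem condGoodOddsDepthOneInt_of_modTotal_farMoment
    (h : ∀ (L : ℕ), ∃ c₀ : ℝ, 0 < c₀ ∧ c₀ ≤ 1 ∧ ∀ (c : ℝ), 0 < c → c ≤ c₀ → ∃ pS : ℝ, ∀ (b₀ p₀ : ℝ), 0 < b₀ → pS ≤ p₀ → 0 < p₀ →
      ∃ γ₁ : ℝ, 0 < γ₁ ∧ ∀ (F : T3Family) (γ : ℝ), F.L = L → 0 < γ → γ ≤ γ₁ →
        ∃ (δ₀ : ℝ) (J₀ : ℕ) (s q : ℕ → ℝ) (σm : (J : ℕ) → Plaq (F.P (J + 1)) 0 → ℝ) (M : ℕ → ℝ), 0 ≤ δ₀ ∧ (∀ J, 0 ≤ s J) ∧ (∀ J, J₀ ≤ J → s J ≤ 1 / 2) ∧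
          (∀ a : ℕ, Tendsto (fun J : ℕ => ((J : ℝ) + 1) ^ a * s J) atTop (𝓝 0)) ∧ (∀ J p, 0 ≤ σm J p) ∧
          (∀ J, ∑ p : Plaq (F.P (J + 1)) 0, σm J p +
              (Fintype.card (Plaq (F.P (J + 1)) 0) : ℝ) * (Real.exp (-((F.scheme ℰp γ).β (J + 1) * δ₀ ^ 2 / 4)) * Real.exp (M J)) ≤ s J) ∧
          (∀ J, 0 < q J) ∧
          (∀ (J : ℕ), J < J₀ → ∀ (B : Set (GaugeField (F.P J) 0 (Matrix.specialUnitaryGroup (Fin 2) ℂ))), MeasurableSet B →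
            B ⊆ {U | PlaqSmall (θBal F.L γ (c * b₀) p₀ J) U} →
            ENNReal.ofReal (q J) * gibbsK F ℰp γ (J + 1) (descendTo F ℰp J (J + 1) (Nat.le_succ J) ⁻¹' B) ≤
              gibbsK F ℰp γ (J + 1) (descendTo F ℰp J (J + 1) (Nat.le_succ J) ⁻¹' B ∩ histGood F ℰp (θBal F.L γ b₀ p₀) (J + 1) J)) ∧
          (∀ (J : ℕ) (p : Plaq (F.P (J + 1)) 0) (B : Set (GaugeField (F.P J) 0 (Matrix.specialUnitaryGroup (Fin 2) ℂ))), MeasurableSet B →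
            B ⊆ {U | PlaqSmall (θBal F.L γ (c * b₀) p₀ J) U} →
            gibbsK F ℰp γ (J + 1) (descendTo F ℰp J (J + 1) (Nat.le_succ J) ⁻¹' B ∩
                {U | θBal F.L γ b₀ p₀ (J + 1) ≤ dist1 (GaugeField.plaqHol U p) ∧ dist1 (GaugeField.plaqHol U p) < δ₀}) ≤
              ENNReal.ofReal (σm J p) * gibbsK F ℰp γ (J + 1) (descendTo F ℰp J (J + 1) (Nat.le_succ J) ⁻¹' B)) ∧
          (∀ (J : ℕ) (p : Plaq (F.P (J + 1)) 0),
            ∀ᵐ V ∂((fieldMeasure (F.P (J + 1)) 0 (Matrix.specialUnitaryGroup (Fin 2) ℂ)).map (descendTo F ℰp J (J + 1) (Nat.le_succ J))),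
              PlaqSmall (θBal F.L γ (c * b₀) p₀ J) V →
                ⨍ U, (F.scheme ℰp γ).β (J + 1) * (1 - reTr (GaugeField.plaqHol U p))
                  ∂((condLaw (fieldMeasure (F.P (J + 1)) 0 (Matrix.specialUnitaryGroup (Fin 2) ℂ)) (descendTo F ℰp J (J + 1) (Nat.le_succ J)) V).withDensity
                    fun U => ENNReal.ofReal (Real.exp (-((F.scheme ℰp γ).β (J + 1) *
                      (wilsonAction4 U - (1 - reTr (GaugeField.plaqHol U p))))))) ≤ M J)) :
    ∀ (L : ℕ), ∃ c₀ : ℝ, 0 < c₀ ∧ c₀ ≤ 1 ∧ ∀ (c : ℝ), 0 < c → c ≤ c₀ → ∃ pS : ℝ, ∀ (b₀ p₀ : ℝ), 0 < b₀ → pS ≤ p₀ → 0 < p₀ →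
      ∃ γ₁ : ℝ, 0 < γ₁ ∧ ∀ (F : T3Family) (γ : ℝ), F.L = L → 0 < γ → γ ≤ γ₁ →
        ∃ τ : ℕ → ℝ, (∀ J, 0 ≤ τ J) ∧ (∀ a : ℕ, Tendsto (fun J : ℕ => ((J : ℝ) + 1) ^ a * τ J) atTop (𝓝 0)) ∧
          ∀ (J : ℕ) (B : Set (GaugeField (F.P J) 0 (Matrix.specialUnitaryGroup (Fin 2) ℂ))), MeasurableSet B →
            B ⊆ {U | PlaqSmall (θBal F.L γ (c * b₀) p₀ J) U} →
            gibbsK F ℰp γ (J + 1) (descendTo F ℰp J (J + 1) (Nat.le_succ J) ⁻¹' B) ≤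
              ENNReal.ofReal (Real.exp (τ J)) *
                gibbsK F ℰp γ (J + 1) (descendTo F ℰp J (J + 1) (Nat.le_succ J) ⁻¹' B ∩ histGood F ℰp (θBal F.L γ b₀ p₀) (J + 1) J) := by
  intro L
  obtain ⟨c₀, hc₀, hc₀1, hc⟩ := h L
  refine ⟨c₀, hc₀, hc₀1, fun c hcpos hcle => ?_⟩
  obtain ⟨pS, hpS⟩ := hc c hcpos hcle
  refine ⟨pS, fun b₀ p₀ hb₀ hpS' hp₀ => ?_⟩
  obtain ⟨γ₁, hγ₁, hγ₁F⟩ := hpS b₀ p₀ hb₀ hpS' hp₀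
  refine ⟨min γ₁ 1, lt_min hγ₁ one_pos, fun F γ hFL hγ hγle => ?_⟩
  have hγ1 : γ ≤ 1 := le_trans hγle (min_le_right γ₁ 1)
  obtain ⟨δ₀, J₀, s, q, σm, M, hδ₀, hs0, hshalf, hsa, hσm0, hsmall, hq, hfloor, hmod, hfar⟩ :=
    hγ₁F F γ hFL hγ (le_trans hγle (min_le_left γ₁ 1))
  refine ⟨fun J => if J < J₀ then max 0 (-Real.log (q J)) else 2 * s J, fun J => ?_, ?_, ?_⟩
  · dsimp only
    by_cases hJ : J < J₀
    · rw [if_pos hJ]; exact le_max_left _ _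
    · rw [if_neg hJ]; linarith [hs0 J]
  · refine superpoly_of_eventually_eq J₀ (fun J hJ => ?_) hsa
    rw [if_neg (not_lt.mpr hJ)]
  intro J B hB hBW
  dsimp only
  by_cases hJ : J < J₀
  · -- the finitely many low levels: the floor
    rw [if_pos hJ]
    exact le_exp_negLog_mul_of_floor (hq J) (hfloor J hJ B hB hBW)
  rw [if_neg hJ]
  have hBJ : B ⊆ {U : GaugeField (F.P J) 0 (Matrix.specialUnitaryGroup (Fin 2) ℂ) | PlaqSmall (θBal F.L γ b₀ p₀ J) U} := fun U hU =>
    T3PrintedMinimiserExistence.plaqSmall_of_le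
      (T3InteriorExcision.θBal_mul_le (le_of_lt F.hL.2) hγ hγ1 hb₀ (hcle.trans hc₀1) p₀ J) (hBW hU)
  -- the far weight, one number per level
  set wf : ℝ := Real.exp (-((F.scheme ℰp γ).β (J + 1) * δ₀ ^ 2 / 4)) * Real.exp (M J) with hwf
  have hwf0 : 0 ≤ wf := mul_nonneg (Real.exp_nonneg _) (Real.exp_nonneg _)
  have hsumf : ∑ _p : Plaq (F.P (J + 1)) 0, wf = (Fintype.card (Plaq (F.P (J + 1)) 0) : ℝ) * wf := by
    rw [Finset.sum_const, Finset.card_univ, nsmul_eq_mul]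
  have hsum : ∑ p : Plaq (F.P (J + 1)) 0, σm J p + ∑ _p : Plaq (F.P (J + 1)) 0, wf ≤ 1 / 2 := by
    rw [hsumf]; exact (hsmall J).trans (hshalf J (not_lt.mp hJ))
  have hmain := condGoodOddsDepthOne_of_modFarRowsFineTotal F hγ.le (θBal F.L γ b₀ p₀) J δ₀ (σm J) (fun _ => wf) (hσm0 J)
    (fun _ => hwf0) hsum hBJ (fun p => hmod J p B hB hBW)
    (fun p => farPinnedTotal_of_firstMoment F (c * b₀) p₀ (Nat.le_succ J) hγ.le hδ₀ p (hfar J p) hB hBW)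
  refine hmain.trans (mul_le_mul' (ENNReal.ofReal_le_ofReal (Real.exp_le_exp.mpr ?_)) le_rfl)
  rw [hsumf]
  linarith [hsmall J]

/-- ★★★ **⟨MOD-TOTAL₁∘ + FAR-MOMENT₁∘ + FLOOR⟩ ⇒ TAILSUP₁∘** (LINE g21-2 v1.4's interior row `RunPairOrgan.OneLoop.WindowOddsSupDepthOneIntCan`, text verbatim): §3 then ✓K
`windowOddsSupDepthOneIntCan_of_condGoodOddsDepthOneInt`.  WHAT THE HAND STILL OWES: the MODERATE per-plaquette rows in total-mass currency for `J ≥ J₀` (chart + uniform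
convexity one level deep — ✓E∕✓G's input, px20's E-CHART∕F-BOX∕F-η), ONE first-moment bound per level for the deleted-weight fibre law (equipartition), the eventual
smallness (large `p₀`; `J₀` after `F`), and the FLOOR at the finitely many `J < J₀` (LINE g22-2's positivity ∕ persistence row).  HONEST SCOPE: those are the HYPOTHESIS;
nothing upstream is proved here. [cite: Balaban1985UV3, (2) p.256, (7) p.257, (38)-(40) p.266 and (67)-(71) p.273] -/
theorem windowOddsSupDepthOneInt_of_modTotal_farMoment
    (h : ∀ (L : ℕ), ∃ c₀ : ℝ, 0 < c₀ ∧ c₀ ≤ 1 ∧ ∀ (c : ℝ), 0 < c → c ≤ c₀ → ∃ pS : ℝ, ∀ (b₀ p₀ : ℝ), 0 < b₀ → pS ≤ p₀ → 0 < p₀ →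
      ∃ γ₁ : ℝ, 0 < γ₁ ∧ ∀ (F : T3Family) (γ : ℝ), F.L = L → 0 < γ → γ ≤ γ₁ →
        ∃ (δ₀ : ℝ) (J₀ : ℕ) (s q : ℕ → ℝ) (σm : (J : ℕ) → Plaq (F.P (J + 1)) 0 → ℝ) (M : ℕ → ℝ), 0 ≤ δ₀ ∧ (∀ J, 0 ≤ s J) ∧ (∀ J, J₀ ≤ J → s J ≤ 1 / 2) ∧
          (∀ a : ℕ, Tendsto (fun J : ℕ => ((J : ℝ) + 1) ^ a * s J) atTop (𝓝 0)) ∧ (∀ J p, 0 ≤ σm J p) ∧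
          (∀ J, ∑ p : Plaq (F.P (J + 1)) 0, σm J p +
              (Fintype.card (Plaq (F.P (J + 1)) 0) : ℝ) * (Real.exp (-((F.scheme ℰp γ).β (J + 1) * δ₀ ^ 2 / 4)) * Real.exp (M J)) ≤ s J) ∧
          (∀ J, 0 < q J) ∧
          (∀ (J : ℕ), J < J₀ → ∀ (B : Set (GaugeField (F.P J) 0 (Matrix.specialUnitaryGroup (Fin 2) ℂ))), MeasurableSet B →
            B ⊆ {U | PlaqSmall (θBal F.L γ (c * b₀) p₀ J) U} →
            ENNReal.ofReal (q J) * gibbsK F ℰp γ (J + 1) (descendTo F ℰp J (J + 1) (Nat.le_succ J) ⁻¹' B) ≤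
              gibbsK F ℰp γ (J + 1) (descendTo F ℰp J (J + 1) (Nat.le_succ J) ⁻¹' B ∩ histGood F ℰp (θBal F.L γ b₀ p₀) (J + 1) J)) ∧
          (∀ (J : ℕ) (p : Plaq (F.P (J + 1)) 0) (B : Set (GaugeField (F.P J) 0 (Matrix.specialUnitaryGroup (Fin 2) ℂ))), MeasurableSet B →
            B ⊆ {U | PlaqSmall (θBal F.L γ (c * b₀) p₀ J) U} →
            gibbsK F ℰp γ (J + 1) (descendTo F ℰp J (J + 1) (Nat.le_succ J) ⁻¹' B ∩
                {U | θBal F.L γ b₀ p₀ (J + 1) ≤ dist1 (GaugeField.plaqHol U p) ∧ dist1 (GaugeField.plaqHol U p) < δ₀}) ≤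
              ENNReal.ofReal (σm J p) * gibbsK F ℰp γ (J + 1) (descendTo F ℰp J (J + 1) (Nat.le_succ J) ⁻¹' B)) ∧
          (∀ (J : ℕ) (p : Plaq (F.P (J + 1)) 0),
            ∀ᵐ V ∂((fieldMeasure (F.P (J + 1)) 0 (Matrix.specialUnitaryGroup (Fin 2) ℂ)).map (descendTo F ℰp J (J + 1) (Nat.le_succ J))),
              PlaqSmall (θBal F.L γ (c * b₀) p₀ J) V →
                ⨍ U, (F.scheme ℰp γ).β (J + 1) * (1 - reTr (GaugeField.plaqHol U p))
                  ∂((condLaw (fieldMeasure (F.P (J + 1)) 0 (Matrix.specialUnitaryGroup (Fin 2) ℂ)) (descendTo F ℰp J (J + 1) (Nat.le_succ J)) V).withDensity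
                    fun U => ENNReal.ofReal (Real.exp (-((F.scheme ℰp γ).β (J + 1) *
                      (wilsonAction4 U - (1 - reTr (GaugeField.plaqHol U p))))))) ≤ M J)) :
    ∀ (L : ℕ), ∃ c₀ : ℝ, 0 < c₀ ∧ c₀ ≤ 1 ∧ ∀ (c : ℝ), 0 < c → c ≤ c₀ → ∃ pS : ℝ, ∀ (b₀ p₀ : ℝ), 0 < b₀ → pS ≤ p₀ → 0 < p₀ →
    ∃ γ₁ : ℝ, 0 < γ₁ ∧ ∀ (F : T3Family) (γ : ℝ), F.L = L → 0 < γ → γ ≤ γ₁ →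
      ∃ τ : ℕ → ℝ, (∀ J, 0 ≤ τ J) ∧ (∀ a : ℕ, Tendsto (fun J : ℕ => ((J : ℝ) + 1) ^ a * τ J) atTop (𝓝 0)) ∧
        ∀ (ν : ℕ → (j : ℕ) → Measure (GaugeField (F.P j) 0 (Matrix.specialUnitaryGroup (Fin 2) ℂ))),
          (∀ K, ν K K = T4GenFunBounds.gibbsMeasure (F.P K) ((F.scheme ℰp γ).β K)) →
          (∀ K j, j < K → ν K j = Measure.map (descend F ℰp j) (ν K (j + 1))) →
          ∀ (J : ℕ) (ρ : GaugeField (F.P J) 0 (Matrix.specialUnitaryGroup (Fin 2) ℂ) → ℝ),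
            (∀ U, PlaqSmall (θBal F.L γ (c * b₀) p₀ J) U → 0 < ρ U) →
            ν (J + 1) J = (fieldMeasure _ _ _).withDensity (fun U => ENNReal.ofReal (ρ U)) →
            ContinuousOn ρ {U | PlaqSmall (θBal F.L γ (c * b₀) p₀ J) U} →
            (∀ U : GaugeField (F.P J) 0 (Matrix.specialUnitaryGroup (Fin 2) ℂ), PlaqSmall (θBal F.L γ (c * b₀) p₀ J) U →
                0 < heightDensityCan F γ (Nat.le_succ J) (histGood F ℰp (θBal F.L γ b₀ p₀) (J + 1) J) U) →
            ∃ a₀ : ℝ, ∀ U : GaugeField (F.P J) 0 (Matrix.specialUnitaryGroup (Fin 2) ℂ), PlaqSmall (θBal F.L γ (c * b₀) p₀ J) U →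
              0 ≤ Real.log (ρ U) - a₀ - Real.log (heightDensityCan F γ (Nat.le_succ J) (histGood F ℰp (θBal F.L γ b₀ p₀) (J + 1) J) U) ∧
              Real.log (ρ U) - a₀ - Real.log (heightDensityCan F γ (Nat.le_succ J) (histGood F ℰp (θBal F.L γ b₀ p₀) (J + 1) J) U) ≤ τ J :=
  FluctuationComparisonRegPrIntLSupTailReductionInt.windowOddsSupDepthOneIntCan_of_condGoodOddsDepthOneInt
    (condGoodOddsDepthOneInt_of_modTotal_farMoment h)

end Knit

end Summit.QuantumFields.YangMills.Theorems.FluctuationComparisonRegPrIntLSupTailCoverUnionTwoRegime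

end
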